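import Literature.AnabelianGeometry.SemiGraphs.BranchSubgroupFrames
import Literature.AnabelianGeometry.SemiGraphs.HomComposition
import Literature.AnabelianGeometry.Anabelioids.FiberFunctorUnique
import Literature.AnabelianGeometry.Anabelioids.ExactFunctorProofs
import HarnessLib

/-!
# Branch alignment is stable under composition of morphisms of semi-graphs of anabelioids ([SemiAnbd] §2)

Mochizuki, *Semi-graphs of anabelioids*, Publ. RIMS **42** (2006) 221–322, §2: Definition 2.2 (i)
p. 23 (finite étale coverings), Remarks 2.4.1–2.4.2 p. 26 (branch groups of coverings; composition
of 1-morphisms) [cite: MochizukiSemiAnbd2006, Rem. 2.4.2 p.26].  PROOF-ONLY file (abc-iut cell,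
F-1478 `remark_2_4_1_covering`: its residual is the closure of print's covering notion
`Hom.IsFiniteEtaleCoveringGlobal` under `Hom.comp`; this is brick (B) "branch-aligned transport",
abc-iut-w5-d177).  For `ψ : 𝒢″ → 𝒢′`, `φ : 𝒢′ → 𝒢` and the composite `ψ.comp φ` (`HomComposition`):
* `Hom.alignIso_comp`, `Hom.alignedBranchSubgroup_comp` — the ALIGNED FRAME (and aligned branch
  subgroup `Π_b^{al}`) of the composite at `b″` over `b` is that of `φ` at the intermediate branch
  `b′ = ψ b″` for the basepoint data INDUCED by `ψ` (`ψ_{v″}^*F″`, `ψ_{e″}^*F_e″`, `ψ.alignIso`), up to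
  the bridge `compEIso` between the two presentations of the intermediate edge;
* `Hom.transition_comp`, `Hom.exists_transition_comp_eq_mul` — the transition element of clause
  (ii) for the composite is a transition element of `φ`; over ONE intermediate branch it factors as
  `g · ι_φ(t_ψ)`, `g ∈ Π_{b,1}^{al}`, `t_ψ` a transition element of `ψ` (`alignIso_transition_eq`);
* `Hom.IsBranchAligned.comp` — **`ψ`, `φ` branch-aligned ⇒ `ψ.comp φ` branch-aligned**: clause (i)
  is `φ`-(i) at the induced frame then `ψ`-(i); clause (ii) is `φ`-(ii) when `ψ b″₁ ≠ ψ b″₂`, and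
  otherwise `ψ`-(ii) via the factorisation and `φ`-(i) (a relation `t = β · ι_{ψφ}(u)` would put
  `t_ψ` in `Π_{b′,1}^{al}(ψ) · ι_ψ(u)`).  No finiteness or injectivity input: alignment alone composes.
Nothing here takes a side on [IUTchIII] Cor. 3.12; no new definitions.
-/

namespace Literature.AnabelianGeometry.SemiGraphs

open CategoryTheory CategoryTheory.Functor CategoryTheory.PreGaloisCategory
open Literature.AnabelianGeometry.Anabelioids

universe v₁ u₁ u

namespace SemiGraphOfAnabelioids

variable {𝒢'' 𝒢' 𝒢 : SemiGraphOfAnabelioids.{v₁, u₁, u}}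

/-- At the canonical presentation `b = φ b′` the transported 2-cell `φ_{b′}` is `φ_{b′}` itself.
[cite: MochizukiSemiAnbd2006, Rem. 2.4.2 p.26] -/
theorem Hom.φBOver_rfl (φ : Hom 𝒢' 𝒢) (b' : 𝒢'.graph.Branch) (v' : 𝒢'.graph.Vertex)
    (h' : 𝒢'.graph.abuts b' = some v') :
    φ.φBOver b' v' h' (φ.base.branchMap b') rfl = φ.φB b' v' h' := rfl

/-- `π₁` of a composite pull-back functor is the composite of the `π₁`'s:
`ι_{ψφ} = ι_φ ∘ ι_ψ` on `Π_{v″}` (local copy of the tree's `pi1Map_comp_apply`).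
[cite: MochizukiGeoAn2004, Def. 1.1.2(ii) p.10] -/
theorem pi1Map_comp_φV (ψ : Hom 𝒢'' 𝒢') (φ : Hom 𝒢' 𝒢) (v'' : 𝒢''.graph.Vertex)
    (F'' : 𝒢''.V v'' ⥤ FintypeCat.{v₁}) (σ : Aut F'') :
    pi1Map ((ψ.comp φ).φV v'').pullback F'' σ =
      pi1Map (φ.φV (ψ.base.vertexMap v'')).pullback ((ψ.φV v'').pullback ⋙ F'')
        (pi1Map (ψ.φV v'').pullback F'' σ) := rfl

/-- Components of the inverse of the pasted 2-cell `(ψφ)_{b″}` of a composite ([SemiAnbd] Rmk 2.4.2):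
the bridge `compEIso`, then `ψ_{e″}^*` of `φ_{ψ b″}⁻¹`, then `ψ_{b″}⁻¹`.
[cite: MochizukiSemiAnbd2006, Rem. 2.4.2 p.26] -/
theorem Hom.comp_φB_inv_app (ψ : Hom 𝒢'' 𝒢') (φ : Hom 𝒢' 𝒢) (b'' : 𝒢''.graph.Branch)
    (v'' : 𝒢''.graph.Vertex) (h'' : 𝒢''.graph.abuts b'' = some v'')
    (X : 𝒢.V ((ψ.comp φ).base.vertexMap v'')) :
    ((ψ.comp φ).φB b'' v'' h'').inv.app X =
      (ψ.over.compEIso φ.over (𝒢''.graph.edgeOf b'') (𝒢'.graph.edgeOf (ψ.base.branchMap b''))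
          (ψ.base.edgeOf_branchMap b'').symm (𝒢.graph.edgeOf ((ψ.comp φ).base.branchMap b''))
          (φ.base.edgeOf_branchMap (ψ.base.branchMap b'')).symm).inv.app
          ((𝒢.pull ((ψ.comp φ).base.branchMap b'') ((ψ.comp φ).base.vertexMap v'')
            ((ψ.comp φ).base.abuts_branchMap b'' v'' h'')).pullback.obj X) ≫
        (ψ.φE (𝒢''.graph.edgeOf b'') (𝒢'.graph.edgeOf (ψ.base.branchMap b''))
            (ψ.base.edgeOf_branchMap b'').symm).pullback.map
          ((φ.φB (ψ.base.branchMap b'') (ψ.base.vertexMap v'')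
            (ψ.base.abuts_branchMap b'' v'' h'')).inv.app X) ≫
        (ψ.φB b'' v'' h'').inv.app ((φ.φV (ψ.base.vertexMap v'')).pullback.obj X) := by
  show (ψ.over.compCell φ.over _ _ _ _ _ _ _ (ψ.φB b'' v'' h'')
    (φ.φB (ψ.base.branchMap b'') (ψ.base.vertexMap v'') (ψ.base.abuts_branchMap b'' v'' h''))).inv.app X = _
  simp only [HomOver.compCell, Iso.trans_inv, NatTrans.comp_app, isoWhiskerLeft_inv, whiskerLeft_app,
    pasteIso_inv_app]
  rfl

section Frame

variable (ψ : Hom 𝒢'' 𝒢') (φ : Hom 𝒢' 𝒢) (b'' : 𝒢''.graph.Branch) (v'' : 𝒢''.graph.Vertex)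
  (h'' : 𝒢''.graph.abuts b'' = some v'') (b' : 𝒢'.graph.Branch) (q : ψ.base.branchMap b'' = b')
  (b : 𝒢.graph.Branch) (p' : φ.base.branchMap b' = b) (p : (ψ.comp φ).base.branchMap b'' = b)
  (F'' : 𝒢''.V v'' ⥤ FintypeCat.{v₁}) (Fe'' : 𝒢''.E (𝒢''.graph.edgeOf b'') ⥤ FintypeCat.{v₁})
  (α'' : (𝒢''.pull b'' v'' h'').pullback ⋙ Fe'' ≅ F'')

/-- **The aligned frame of a composite.** `(ψφ).alignIso` at `b″` over `b` equals, after the bridge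
`compEIso` between the two presentations `ψ e″` / `e′` of the intermediate edge (whiskered on the
left by `b^*` and on the right by `F_e″`), the aligned frame of `φ` at `b′` for the basepoint data
induced by `ψ`: `F′ := ψ_{v″}^* ⋙ F″`, `F_e′ := ψ_{e″}^* ⋙ F_e″`, `α′ := ψ.alignIso`.
[cite: MochizukiSemiAnbd2006, Rem. 2.4.2 p.26] -/
theorem Hom.alignIso_comp :
    (ψ.comp φ).alignIso b'' v'' h'' b p F'' Fe'' α'' =
      isoWhiskerLeft (𝒢.pull b ((ψ.comp φ).base.vertexMap v'')
          (p ▸ (ψ.comp φ).base.abuts_branchMap b'' v'' h'')).pullback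
        (isoWhiskerRight (ψ.over.compEIso φ.over (𝒢''.graph.edgeOf b'') (𝒢'.graph.edgeOf b')
          (ψ.edgeMap_edgeOf_eq_of_branchMap_eq b' b'' q) (𝒢.graph.edgeOf b)
          (φ.edgeMap_edgeOf_eq_of_branchMap_eq b b' p')) Fe'').symm ≪≫
      φ.alignIso b' (ψ.base.vertexMap v'') (q ▸ ψ.base.abuts_branchMap b'' v'' h'') b p'
        ((ψ.φV v'').pullback ⋙ F'')
        ((ψ.φE (𝒢''.graph.edgeOf b'') (𝒢'.graph.edgeOf b')
          (ψ.edgeMap_edgeOf_eq_of_branchMap_eq b' b'' q)).pullback ⋙ Fe'')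
        (ψ.alignIso b'' v'' h'' b' q F'' Fe'' α'') := by
  subst q; subst p'
  obtain rfl : p = rfl := rfl
  refine Iso.ext (NatTrans.ext (funext fun X => ?_))
  simp only [Hom.alignIso, Iso.trans_hom, Iso.symm_hom, isoWhiskerRight_inv,
    isoWhiskerLeft_hom, NatTrans.comp_app, whiskerRight_app, whiskerLeft_app]
  erw [Hom.φBOver_rfl, Hom.φBOver_rfl, Hom.φBOver_rfl, Hom.comp_φB_inv_app]
  erw [Functor.map_comp, Functor.map_comp]
  simp only [Functor.comp_map]
  rfl

/-- **The aligned branch subgroup of a composite** is the aligned branch subgroup of `φ` at the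
intermediate branch for the basepoint data induced by `ψ`:
`Π_b^{al}(ψφ; F″, F_e″, α″) = Π_b^{al}(φ; ψ_{v″}^*F″, ψ_{e″}^*F_e″, ψ.alignIso) ⊆ Π_v`.
[cite: MochizukiSemiAnbd2006, Rem. 2.4.1 p.26] -/
theorem Hom.alignedBranchSubgroup_comp :
    (ψ.comp φ).alignedBranchSubgroup b'' v'' h'' b p F'' Fe'' α'' =
      φ.alignedBranchSubgroup b' (ψ.base.vertexMap v'') (q ▸ ψ.base.abuts_branchMap b'' v'' h'') b p'
        ((ψ.φV v'').pullback ⋙ F'')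
        ((ψ.φE (𝒢''.graph.edgeOf b'') (𝒢'.graph.edgeOf b')
          (ψ.edgeMap_edgeOf_eq_of_branchMap_eq b' b'' q)).pullback ⋙ Fe'')
        (ψ.alignIso b'' v'' h'' b' q F'' Fe'' α'') := by
  rw [Hom.alignedBranchSubgroup, Hom.alignedBranchSubgroup,
    Hom.alignIso_comp ψ φ b'' v'' h'' b' q b p' p F'' Fe'' α'']
  exact branchSubgroup_isoWhiskerLeft_trans 𝒢 _ b _ _ _

/-- Components of the aligned frame of a composite (`Hom.alignIso_comp`, `hom` direction).
[cite: MochizukiSemiAnbd2006, Rem. 2.4.2 p.26] -/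
theorem Hom.alignIso_comp_hom_app (X : 𝒢.V ((ψ.comp φ).base.vertexMap v'')) :
    ((ψ.comp φ).alignIso b'' v'' h'' b p F'' Fe'' α'').hom.app X =
      Fe''.map ((ψ.over.compEIso φ.over (𝒢''.graph.edgeOf b'') (𝒢'.graph.edgeOf b')
          (ψ.edgeMap_edgeOf_eq_of_branchMap_eq b' b'' q) (𝒢.graph.edgeOf b)
          (φ.edgeMap_edgeOf_eq_of_branchMap_eq b b' p')).inv.app
          ((𝒢.pull b ((ψ.comp φ).base.vertexMap v'')
            (p ▸ (ψ.comp φ).base.abuts_branchMap b'' v'' h'')).pullback.obj X)) ≫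
        (φ.alignIso b' (ψ.base.vertexMap v'') (q ▸ ψ.base.abuts_branchMap b'' v'' h'') b p'
          ((ψ.φV v'').pullback ⋙ F'')
          ((ψ.φE (𝒢''.graph.edgeOf b'') (𝒢'.graph.edgeOf b')
            (ψ.edgeMap_edgeOf_eq_of_branchMap_eq b' b'' q)).pullback ⋙ Fe'')
          (ψ.alignIso b'' v'' h'' b' q F'' Fe'' α'')).hom.app X := by
  rw [Hom.alignIso_comp ψ φ b'' v'' h'' b' q b p' p F'' Fe'' α'']
  rfl

/-- Components of the aligned frame of a composite (`Hom.alignIso_comp`, `inv` direction).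
[cite: MochizukiSemiAnbd2006, Rem. 2.4.2 p.26] -/
theorem Hom.alignIso_comp_inv_app (X : 𝒢.V ((ψ.comp φ).base.vertexMap v'')) :
    ((ψ.comp φ).alignIso b'' v'' h'' b p F'' Fe'' α'').inv.app X =
      (φ.alignIso b' (ψ.base.vertexMap v'') (q ▸ ψ.base.abuts_branchMap b'' v'' h'') b p'
          ((ψ.φV v'').pullback ⋙ F'')
          ((ψ.φE (𝒢''.graph.edgeOf b'') (𝒢'.graph.edgeOf b')
            (ψ.edgeMap_edgeOf_eq_of_branchMap_eq b' b'' q)).pullback ⋙ Fe'')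
          (ψ.alignIso b'' v'' h'' b' q F'' Fe'' α'')).inv.app X ≫
      Fe''.map ((ψ.over.compEIso φ.over (𝒢''.graph.edgeOf b'') (𝒢'.graph.edgeOf b')
          (ψ.edgeMap_edgeOf_eq_of_branchMap_eq b' b'' q) (𝒢.graph.edgeOf b)
          (φ.edgeMap_edgeOf_eq_of_branchMap_eq b b' p')).hom.app
          ((𝒢.pull b ((ψ.comp φ).base.vertexMap v'')
            (p ▸ (ψ.comp φ).base.abuts_branchMap b'' v'' h'')).pullback.obj X)) := by
  rw [Hom.alignIso_comp ψ φ b'' v'' h'' b' q b p' p F'' Fe'' α'']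
  rfl

end Frame

/-- Generic bookkeeping in `Aut`: inserting an automorphism `γ` of the edge basepoint into a
transition element multiplies it ON THE LEFT by the corresponding element
`AI₁⁻¹ ≫ P◁γ ≫ AI₁` of the branch subgroup in the frame `AI₁`. [folklore] -/
private theorem transition_trans_eq_mul {C : Type*} [Category C] {D : Type*} [Category D] (P : C ⥤ D)
    {G₁ G₂ : D ⥤ FintypeCat.{v₁}} {T : C ⥤ FintypeCat.{v₁}} (AI₁ : P ⋙ G₁ ≅ T) (AI₂ : P ⋙ G₂ ≅ T)
    (η : G₂ ≅ G₁) (γ : G₁ ≅ G₁) :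
    (AI₂.symm ≪≫ isoWhiskerLeft P (η ≪≫ γ) ≪≫ AI₁ : Aut T) =
      @HMul.hMul (Aut T) (Aut T) (Aut T) instHMul (Aut.autMulEquivOfIso AI₁ (pi1Map P G₁ γ))
        (AI₂.symm ≪≫ isoWhiskerLeft P η ≪≫ AI₁) := by
  apply Aut.ext
  refine NatTrans.ext (funext fun X => ?_)
  simp [Aut.Aut_mul_def, Aut.autMulEquivOfIso, pi1Map_hom_app]

section Transition

variable (ψ : Hom 𝒢'' 𝒢') (φ : Hom 𝒢' 𝒢) (v'' : 𝒢''.graph.Vertex) (F'' : 𝒢''.V v'' ⥤ FintypeCat.{v₁})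
  (b : 𝒢.graph.Branch)
  (b''₁ : 𝒢''.graph.Branch) (h₁ : 𝒢''.graph.abuts b''₁ = some v'') (b'₁ : 𝒢'.graph.Branch)
  (q₁ : ψ.base.branchMap b''₁ = b'₁) (p'₁ : φ.base.branchMap b'₁ = b)
  (p₁ : (ψ.comp φ).base.branchMap b''₁ = b)
  (Fe''₁ : 𝒢''.E (𝒢''.graph.edgeOf b''₁) ⥤ FintypeCat.{v₁})
  (α''₁ : (𝒢''.pull b''₁ v'' h₁).pullback ⋙ Fe''₁ ≅ F'')
  (b''₂ : 𝒢''.graph.Branch) (h₂ : 𝒢''.graph.abuts b''₂ = some v'') (b'₂ : 𝒢'.graph.Branch)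
  (q₂ : ψ.base.branchMap b''₂ = b'₂) (p'₂ : φ.base.branchMap b'₂ = b)
  (p₂ : (ψ.comp φ).base.branchMap b''₂ = b)
  (Fe''₂ : 𝒢''.E (𝒢''.graph.edgeOf b''₂) ⥤ FintypeCat.{v₁})
  (α''₂ : (𝒢''.pull b''₂ v'' h₂).pullback ⋙ Fe''₂ ≅ F'')
  (θ : ((ψ.comp φ).φE (𝒢''.graph.edgeOf b''₂) (𝒢.graph.edgeOf b)
      (by rw [← p₂]; exact ((ψ.comp φ).base.edgeOf_branchMap b''₂).symm)).pullback ⋙ Fe''₂ ≅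
    ((ψ.comp φ).φE (𝒢''.graph.edgeOf b''₁) (𝒢.graph.edgeOf b)
      (by rw [← p₁]; exact ((ψ.comp φ).base.edgeOf_branchMap b''₁).symm)).pullback ⋙ Fe''₁)

/-- **The transition element of a composite** (alignment clause (ii)) for two branches `b″₁, b″₂`
over `b` and an isomorphism `θ` of the induced edge basepoints of `𝒢_{e(b)}` IS the transition
element of `φ` for the intermediate branches `b′ᵢ = ψ b″ᵢ`, the `ψ`-induced basepoint data, and
`θ` re-bridged along `compEIso` on both sides. [cite: MochizukiSemiAnbd2006, Rem. 2.4.2 p.26] -/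
theorem Hom.transition_comp :
    (((ψ.comp φ).alignIso b''₂ v'' h₂ b p₂ F'' Fe''₂ α''₂).symm ≪≫
        isoWhiskerLeft (𝒢.pull b ((ψ.comp φ).base.vertexMap v'')
          (p₂ ▸ (ψ.comp φ).base.abuts_branchMap b''₂ v'' h₂)).pullback θ ≪≫
        (ψ.comp φ).alignIso b''₁ v'' h₁ b p₁ F'' Fe''₁ α''₁ :
        Aut (((ψ.comp φ).φV v'').pullback ⋙ F'')) =
      ((φ.alignIso b'₂ (ψ.base.vertexMap v'') (q₂ ▸ ψ.base.abuts_branchMap b''₂ v'' h₂) b p'₂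
            ((ψ.φV v'').pullback ⋙ F'')
            ((ψ.φE (𝒢''.graph.edgeOf b''₂) (𝒢'.graph.edgeOf b'₂)
              (ψ.edgeMap_edgeOf_eq_of_branchMap_eq b'₂ b''₂ q₂)).pullback ⋙ Fe''₂)
            (ψ.alignIso b''₂ v'' h₂ b'₂ q₂ F'' Fe''₂ α''₂)).symm ≪≫
        isoWhiskerLeft (𝒢.pull b (φ.base.vertexMap (ψ.base.vertexMap v''))
            (p'₂ ▸ φ.base.abuts_branchMap b'₂ _ (q₂ ▸ ψ.base.abuts_branchMap b''₂ v'' h₂))).pullback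
          ((isoWhiskerRight (ψ.over.compEIso φ.over (𝒢''.graph.edgeOf b''₂) (𝒢'.graph.edgeOf b'₂)
              (ψ.edgeMap_edgeOf_eq_of_branchMap_eq b'₂ b''₂ q₂) (𝒢.graph.edgeOf b)
              (φ.edgeMap_edgeOf_eq_of_branchMap_eq b b'₂ p'₂)) Fe''₂) ≪≫ θ ≪≫
            (isoWhiskerRight (ψ.over.compEIso φ.over (𝒢''.graph.edgeOf b''₁) (𝒢'.graph.edgeOf b'₁)
              (ψ.edgeMap_edgeOf_eq_of_branchMap_eq b'₁ b''₁ q₁) (𝒢.graph.edgeOf b)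
              (φ.edgeMap_edgeOf_eq_of_branchMap_eq b b'₁ p'₁)) Fe''₁).symm) ≪≫
        φ.alignIso b'₁ (ψ.base.vertexMap v'') (q₁ ▸ ψ.base.abuts_branchMap b''₁ v'' h₁) b p'₁
            ((ψ.φV v'').pullback ⋙ F'')
            ((ψ.φE (𝒢''.graph.edgeOf b''₁) (𝒢'.graph.edgeOf b'₁)
              (ψ.edgeMap_edgeOf_eq_of_branchMap_eq b'₁ b''₁ q₁)).pullback ⋙ Fe''₁)
            (ψ.alignIso b''₁ v'' h₁ b'₁ q₁ F'' Fe''₁ α''₁) :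
        Aut ((φ.φV (ψ.base.vertexMap v'')).pullback ⋙ ((ψ.φV v'').pullback ⋙ F''))) := by
  apply Aut.ext
  refine NatTrans.ext (funext fun X => ?_)
  simp only [Iso.trans_hom, Iso.symm_hom, isoWhiskerLeft_hom, isoWhiskerRight_hom,
    isoWhiskerRight_inv, NatTrans.comp_app, whiskerLeft_app, whiskerRight_app]
  rw [Hom.alignIso_comp_inv_app ψ φ b''₂ v'' h₂ b'₂ q₂ b p'₂ p₂ F'' Fe''₂ α''₂,
    Hom.alignIso_comp_hom_app ψ φ b''₁ v'' h₁ b'₁ q₁ b p'₁ p₁ F'' Fe''₁ α''₁]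
  repeat erw [Category.assoc]

end Transition

section Factor

variable (ψ : Hom 𝒢'' 𝒢') (φ : Hom 𝒢' 𝒢) (v'' : 𝒢''.graph.Vertex) (F'' : 𝒢''.V v'' ⥤ FintypeCat.{v₁})
  (b : 𝒢.graph.Branch) (b' : 𝒢'.graph.Branch) (p' : φ.base.branchMap b' = b)
  (b''₁ : 𝒢''.graph.Branch) (h₁ : 𝒢''.graph.abuts b''₁ = some v'')
  (q₁ : ψ.base.branchMap b''₁ = b') (p₁ : (ψ.comp φ).base.branchMap b''₁ = b)
  (Fe''₁ : 𝒢''.E (𝒢''.graph.edgeOf b''₁) ⥤ FintypeCat.{v₁})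
  (α''₁ : (𝒢''.pull b''₁ v'' h₁).pullback ⋙ Fe''₁ ≅ F'')
  (b''₂ : 𝒢''.graph.Branch) (h₂ : 𝒢''.graph.abuts b''₂ = some v'')
  (q₂ : ψ.base.branchMap b''₂ = b') (p₂ : (ψ.comp φ).base.branchMap b''₂ = b)
  (Fe''₂ : 𝒢''.E (𝒢''.graph.edgeOf b''₂) ⥤ FintypeCat.{v₁})
  (α''₂ : (𝒢''.pull b''₂ v'' h₂).pullback ⋙ Fe''₂ ≅ F'')
  (θ : ((ψ.comp φ).φE (𝒢''.graph.edgeOf b''₂) (𝒢.graph.edgeOf b)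
      (by rw [← p₂]; exact ((ψ.comp φ).base.edgeOf_branchMap b''₂).symm)).pullback ⋙ Fe''₂ ≅
    ((ψ.comp φ).φE (𝒢''.graph.edgeOf b''₁) (𝒢.graph.edgeOf b)
      (by rw [← p₁]; exact ((ψ.comp φ).base.edgeOf_branchMap b''₁).symm)).pullback ⋙ Fe''₁)
  (θψ : (ψ.φE (𝒢''.graph.edgeOf b''₂) (𝒢'.graph.edgeOf b')
        (ψ.edgeMap_edgeOf_eq_of_branchMap_eq b' b''₂ q₂)).pullback ⋙ Fe''₂ ≅
      (ψ.φE (𝒢''.graph.edgeOf b''₁) (𝒢'.graph.edgeOf b')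
        (ψ.edgeMap_edgeOf_eq_of_branchMap_eq b' b''₁ q₁)).pullback ⋙ Fe''₁)

/-- **Factorisation of the transition element of a composite through ONE intermediate branch.**
If both `b″₁, b″₂` lie over the same branch `b′` of `𝒢′` (over `b`), then for any isomorphism `θ_ψ`
of the two `ψ`-induced basepoints of `𝒢′_{e′}` ([SGA1] V 5.7) the composite's transition element for
`θ` is `g · ι_φ(t_ψ)` with `g ∈ Π_{b,1}^{al}`: here `t_ψ` is the transition element of `ψ` for `θ_ψ`
(alignment clause (ii) of `ψ`), `ι_φ = π₁(φ_{v′})`, and the witness `g` is the aligned image of the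
edge-group element `γ = (φ_{e′}^*θ_ψ)⁻¹ ≫ θ′` (`θ′` = `θ` re-bridged along `compEIso`);
assembled from `Hom.transition_comp`, `alignIso_transition_eq` and `transition_trans_eq_mul`.
[cite: MochizukiSemiAnbd2006, Rem. 2.4.2 p.26] -/
theorem Hom.exists_transition_comp_eq_mul :
    ∃ g ∈ φ.alignedBranchSubgroup b' (ψ.base.vertexMap v'') (q₁ ▸ ψ.base.abuts_branchMap b''₁ v'' h₁)
        b p' ((ψ.φV v'').pullback ⋙ F'')
        ((ψ.φE (𝒢''.graph.edgeOf b''₁) (𝒢'.graph.edgeOf b')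
          (ψ.edgeMap_edgeOf_eq_of_branchMap_eq b' b''₁ q₁)).pullback ⋙ Fe''₁)
        (ψ.alignIso b''₁ v'' h₁ b' q₁ F'' Fe''₁ α''₁),
      (((ψ.comp φ).alignIso b''₂ v'' h₂ b p₂ F'' Fe''₂ α''₂).symm ≪≫
          isoWhiskerLeft (𝒢.pull b ((ψ.comp φ).base.vertexMap v'')
            (p₂ ▸ (ψ.comp φ).base.abuts_branchMap b''₂ v'' h₂)).pullback θ ≪≫
          (ψ.comp φ).alignIso b''₁ v'' h₁ b p₁ F'' Fe''₁ α''₁ :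
          Aut (((ψ.comp φ).φV v'').pullback ⋙ F'')) =
        g * pi1Map (φ.φV (ψ.base.vertexMap v'')).pullback ((ψ.φV v'').pullback ⋙ F'')
          ((ψ.alignIso b''₂ v'' h₂ b' q₂ F'' Fe''₂ α''₂).symm ≪≫
            isoWhiskerLeft (𝒢'.pull b' (ψ.base.vertexMap v'')
              (q₁ ▸ ψ.base.abuts_branchMap b''₁ v'' h₁)).pullback θψ ≪≫
            ψ.alignIso b''₁ v'' h₁ b' q₁ F'' Fe''₁ α''₁) := by
  refine ⟨Aut.autMulEquivOfIso
    (φ.alignIso b' (ψ.base.vertexMap v'') (q₁ ▸ ψ.base.abuts_branchMap b''₁ v'' h₁) b p'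
      ((ψ.φV v'').pullback ⋙ F'')
      ((ψ.φE (𝒢''.graph.edgeOf b''₁) (𝒢'.graph.edgeOf b')
        (ψ.edgeMap_edgeOf_eq_of_branchMap_eq b' b''₁ q₁)).pullback ⋙ Fe''₁)
      (ψ.alignIso b''₁ v'' h₁ b' q₁ F'' Fe''₁ α''₁))
    (pi1Map (𝒢.pull b (φ.base.vertexMap (ψ.base.vertexMap v''))
        (p' ▸ φ.base.abuts_branchMap b' _ (q₁ ▸ ψ.base.abuts_branchMap b''₁ v'' h₁))).pullback
      ((φ.φE (𝒢'.graph.edgeOf b') (𝒢.graph.edgeOf b)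
          (φ.edgeMap_edgeOf_eq_of_branchMap_eq b b' p')).pullback ⋙
        ((ψ.φE (𝒢''.graph.edgeOf b''₁) (𝒢'.graph.edgeOf b')
          (ψ.edgeMap_edgeOf_eq_of_branchMap_eq b' b''₁ q₁)).pullback ⋙ Fe''₁))
      ((isoWhiskerLeft (φ.φE (𝒢'.graph.edgeOf b') (𝒢.graph.edgeOf b)
          (φ.edgeMap_edgeOf_eq_of_branchMap_eq b b' p')).pullback θψ).symm ≪≫
        ((isoWhiskerRight (ψ.over.compEIso φ.over (𝒢''.graph.edgeOf b''₂) (𝒢'.graph.edgeOf b')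
            (ψ.edgeMap_edgeOf_eq_of_branchMap_eq b' b''₂ q₂) (𝒢.graph.edgeOf b)
            (φ.edgeMap_edgeOf_eq_of_branchMap_eq b b' p')) Fe''₂) ≪≫ θ ≪≫
          (isoWhiskerRight (ψ.over.compEIso φ.over (𝒢''.graph.edgeOf b''₁) (𝒢'.graph.edgeOf b')
            (ψ.edgeMap_edgeOf_eq_of_branchMap_eq b' b''₁ q₁) (𝒢.graph.edgeOf b)
            (φ.edgeMap_edgeOf_eq_of_branchMap_eq b b' p')) Fe''₁).symm))), ⟨_, rfl⟩, ?_⟩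
  rw [Hom.transition_comp ψ φ v'' F'' b b''₁ h₁ b' q₁ p' p₁ Fe''₁ α''₁ b''₂ h₂ b' q₂ p' p₂ Fe''₂ α''₂ θ,
    ← alignIso_transition_eq φ (ψ.base.vertexMap v'') ((ψ.φV v'').pullback ⋙ F'') b b'
      (q₁ ▸ ψ.base.abuts_branchMap b''₁ v'' h₁) p' _ (ψ.alignIso b''₁ v'' h₁ b' q₁ F'' Fe''₁ α''₁)
      _ (ψ.alignIso b''₂ v'' h₂ b' q₂ F'' Fe''₂ α''₂) θψ,
    ← transition_trans_eq_mul, Iso.self_symm_id_assoc]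
  rfl

end Factor

/-- The group theory behind clause (ii) at ONE intermediate branch: if `ι_φ⁻¹(A) ≤ B`,
`g, β ∈ A` and `g · ι_φ(t) = β · ι_φ(ι_ψ(u))`, then `t ∈ B · ι_ψ(u)` (take `w := t · ι_ψ(u)⁻¹`, whose
image `ι_φ(w) = g⁻¹ β` lies in `A`). [folklore] -/
private theorem exists_mem_mul_of_comap_le {Γ'' Γ' Γ : Type*} [Group Γ''] [Group Γ'] [Group Γ]
    (ιψ : Γ'' →* Γ') (ιφ : Γ' →* Γ) {A : Subgroup Γ} {B : Subgroup Γ'} (hA : A.comap ιφ ≤ B)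
    {g β : Γ} (hg : g ∈ A) (hβ : β ∈ A) {t : Γ'} {u : Γ''}
    (h : g * ιφ t = β * ιφ (ιψ u)) : ∃ w ∈ B, t = w * ιψ u := by
  refine ⟨t * (ιψ u)⁻¹, hA ?_, by rw [inv_mul_cancel_right]⟩
  rw [Subgroup.mem_comap, map_mul, _root_.map_inv, eq_inv_mul_of_mul_eq h, mul_assoc,
    mul_inv_cancel_right]
  exact mul_mem (inv_mem hg) hβ

/-- **Branch alignment is stable under composition** ([SemiAnbd] Def. 2.2 (i) p. 23 with Rmk 2.4.2
p. 26; clause of print's finite-étale-covering notion, abc-iut-L4-t17's `Hom.IsBranchAligned`):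
if `ψ : 𝒢″ → 𝒢′` and `φ : 𝒢′ → 𝒢` are branch-aligned, so is `ψ.comp φ : 𝒢″ → 𝒢`.
Clause (i): `ι_{ψφ}⁻¹(Π_b^{al}) = ι_ψ⁻¹(ι_φ⁻¹(Π_b^{al}(φ; induced frame))) ≤ ι_ψ⁻¹(Π_{b′}^{al}(ψ)) ≤ Π_{b″}`
(`Hom.alignedBranchSubgroup_comp`, `φ`-(i), `ψ`-(i)).  Clause (ii): for `b″₁ ≠ b″₂` over `b`, if
`ψ b″₁ ≠ ψ b″₂` the composite's transition element is a transition element of `φ`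
(`Hom.transition_comp`) and `φ`-(ii) applies; if `ψ b″₁ = ψ b″₂ =: b′`, pick an isomorphism `θ_ψ` of
the two induced basepoints of `𝒢′_{e′}` ([SGA1] V 5.7): the transition element is `g · ι_φ(t_ψ)`
with `g ∈ Π_{b,1}^{al}` (`Hom.transition_comp_eq_mul`), so `t = β · ι_{ψφ}(u)` forces
`ι_φ(t_ψ · ι_ψ(u)⁻¹) ∈ Π_{b,1}^{al}`, whence `t_ψ ∈ Π_{b′,1}^{al}(ψ) · ι_ψ(u)` by `φ`-(i) —
contradicting `ψ`-(ii).  No finiteness or injectivity hypothesis is used.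
[cite: MochizukiSemiAnbd2006, Def. 2.2(i) p.23] -/
theorem Hom.IsBranchAligned.comp {ψ : Hom 𝒢'' 𝒢'} {φ : Hom 𝒢' 𝒢} (hψ : ψ.IsBranchAligned)
    (hφ : φ.IsBranchAligned) : (ψ.comp φ).IsBranchAligned := by
  intro v'' F'' _ b
  haveI : FiberFunctor ((ψ.φV v'').pullback ⋙ F'') := fiberFunctor_comp_of_exact _ F''
  constructor
  · -- clause (i): `φ`-(i) at the `ψ`-induced frame, then `ψ`-(i)
    intro b'' h'' p Fe'' _ α''
    haveI : FiberFunctor ((ψ.φE (𝒢''.graph.edgeOf b'') (𝒢'.graph.edgeOf (ψ.base.branchMap b''))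
        (ψ.edgeMap_edgeOf_eq_of_branchMap_eq _ b'' rfl)).pullback ⋙ Fe'') :=
      fiberFunctor_comp_of_exact _ Fe''
    rw [Hom.alignedBranchSubgroup_comp ψ φ b'' v'' h'' (ψ.base.branchMap b'') rfl b p p F'' Fe'' α'']
    intro x hx
    rw [Subgroup.mem_comap, pi1Map_comp_φV] at hx
    have hx' := (hφ (ψ.base.vertexMap v'') ((ψ.φV v'').pullback ⋙ F'') b).1 (ψ.base.branchMap b'')
      (ψ.base.abuts_branchMap b'' v'' h'') p _
      (ψ.alignIso b'' v'' h'' (ψ.base.branchMap b'') rfl F'' Fe'' α'') (Subgroup.mem_comap.mpr hx)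
    exact (hψ v'' F'' (ψ.base.branchMap b'')).1 b'' h'' rfl Fe'' α'' (Subgroup.mem_comap.mpr hx')
  · -- clause (ii)
    intro b''₁ b''₂ h₁ h₂ p₁ p₂ hne Fe''₁ _ α''₁ Fe''₂ _ α''₂ θ β hβ u heq
    rw [pi1Map_comp_φV] at heq
    have hβ' : β ∈ φ.alignedBranchSubgroup (ψ.base.branchMap b''₁) (ψ.base.vertexMap v'')
        (ψ.base.abuts_branchMap b''₁ v'' h₁) b p₁ ((ψ.φV v'').pullback ⋙ F'') _
        (ψ.alignIso b''₁ v'' h₁ (ψ.base.branchMap b''₁) rfl F'' Fe''₁ α''₁) := by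
      rw [← Hom.alignedBranchSubgroup_comp ψ φ b''₁ v'' h₁ (ψ.base.branchMap b''₁) rfl b p₁ p₁
        F'' Fe''₁ α''₁]
      exact hβ
    haveI : FiberFunctor ((ψ.φE (𝒢''.graph.edgeOf b''₁) (𝒢'.graph.edgeOf (ψ.base.branchMap b''₁))
        (ψ.edgeMap_edgeOf_eq_of_branchMap_eq _ b''₁ rfl)).pullback ⋙ Fe''₁) :=
      fiberFunctor_comp_of_exact _ Fe''₁
    by_cases hq : ψ.base.branchMap b''₂ = ψ.base.branchMap b''₁
    · -- ONE intermediate branch `b′ = ψ b″₁ = ψ b″₂`: factor through `ψ`-(ii)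
      haveI : FiberFunctor ((ψ.φE (𝒢''.graph.edgeOf b''₂)
          (𝒢'.graph.edgeOf (ψ.base.branchMap b''₁))
          (ψ.edgeMap_edgeOf_eq_of_branchMap_eq _ b''₂ hq)).pullback ⋙ Fe''₂) :=
        fiberFunctor_comp_of_exact _ Fe''₂
      obtain ⟨θψ⟩ := nonempty_iso_of_fiberFunctor
        ((ψ.φE (𝒢''.graph.edgeOf b''₂) (𝒢'.graph.edgeOf (ψ.base.branchMap b''₁))
          (ψ.edgeMap_edgeOf_eq_of_branchMap_eq _ b''₂ hq)).pullback ⋙ Fe''₂)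
        ((ψ.φE (𝒢''.graph.edgeOf b''₁) (𝒢'.graph.edgeOf (ψ.base.branchMap b''₁))
          (ψ.edgeMap_edgeOf_eq_of_branchMap_eq _ b''₁ rfl)).pullback ⋙ Fe''₁)
      obtain ⟨g, hg, hfac⟩ := Hom.exists_transition_comp_eq_mul ψ φ v'' F'' b
        (ψ.base.branchMap b''₁) p₁ b''₁ h₁ rfl p₁ Fe''₁ α''₁ b''₂ h₂ hq p₂ Fe''₂ α''₂ θ θψ
      rw [hfac] at heq
      obtain ⟨w, hw, hwt⟩ := exists_mem_mul_of_comap_le (pi1Map (ψ.φV v'').pullback F'')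
        (pi1Map (φ.φV (ψ.base.vertexMap v'')).pullback ((ψ.φV v'').pullback ⋙ F''))
        ((hφ (ψ.base.vertexMap v'') ((ψ.φV v'').pullback ⋙ F'') b).1 (ψ.base.branchMap b''₁)
          (ψ.base.abuts_branchMap b''₁ v'' h₁) p₁ _
          (ψ.alignIso b''₁ v'' h₁ (ψ.base.branchMap b''₁) rfl F'' Fe''₁ α''₁)) hg hβ' heq
      exact (hψ v'' F'' (ψ.base.branchMap b''₁)).2 b''₁ b''₂ h₁ h₂ rfl hq hne Fe''₁ α''₁ Fe''₂ α''₂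
        θψ w hw u hwt
    · -- two distinct intermediate branches: `φ`-(ii) verbatim
      haveI : FiberFunctor ((ψ.φE (𝒢''.graph.edgeOf b''₂)
          (𝒢'.graph.edgeOf (ψ.base.branchMap b''₂))
          (ψ.edgeMap_edgeOf_eq_of_branchMap_eq _ b''₂ rfl)).pullback ⋙ Fe''₂) :=
        fiberFunctor_comp_of_exact _ Fe''₂
      rw [Hom.transition_comp ψ φ v'' F'' b b''₁ h₁ (ψ.base.branchMap b''₁) rfl p₁ p₁ Fe''₁ α''₁
        b''₂ h₂ (ψ.base.branchMap b''₂) rfl p₂ p₂ Fe''₂ α''₂ θ] at heq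
      exact (hφ (ψ.base.vertexMap v'') ((ψ.φV v'').pullback ⋙ F'') b).2 (ψ.base.branchMap b''₁)
        (ψ.base.branchMap b''₂) (ψ.base.abuts_branchMap b''₁ v'' h₁)
        (ψ.base.abuts_branchMap b''₂ v'' h₂) p₁ p₂ (Ne.symm hq) _
        (ψ.alignIso b''₁ v'' h₁ (ψ.base.branchMap b''₁) rfl F'' Fe''₁ α''₁) _
        (ψ.alignIso b''₂ v'' h₂ (ψ.base.branchMap b''₂) rfl F'' Fe''₂ α''₂) _ β hβ'
        (pi1Map (ψ.φV v'').pullback F'' u) heq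

end SemiGraphOfAnabelioids

end Literature.AnabelianGeometry.SemiGraphs
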